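import Summits.MatrixMultiplication.MatrixMultiplication.Theorems.SoloBlindMassCalculus

/-!
# The first-hit decomposition of a Kraft mass and the cover step of (K₃)

Sub-programme (K₃) (Kraft inequality `K(τ; S) = ∑_{T ⊆ S, ∑_T h = τ} 2^{-|T|} ≤ 1` for zero-sum-free `h` and
`τ ≠ 0`).  This file records the exact identity behind every "cover" / "transversal" induction for (K₃) and the
inductive step it yields (pen analysis K3.51 (4): in rank `≤ 4` the representation family of every target has a
transversal of size `≤ 3`, and size `≤ 2` — where this step closes the induction — at `97.8 %` of all covering
targets; the residual class, transversal number `3`, is the three-point class 3PT of the brief).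

* FIRST-HIT SUM (`soloBlindFirstHitSum`): for a list `a₁, …, a_t` of elements of `S`,
  `F(τ; a₁ … a_t; S) = K(τ - h a₁; S \ a₁)/2 + K(τ - h a₂; S \ {a₁, a₂})/2 + ⋯ + K(τ; S \ {a₁, …, a_t})`,
  defined by recursion on the list.
* FIRST-HIT DECOMPOSITION (`soloBlind_mass_firstHit`, no hypotheses beyond `aⱼ ∈ S` pairwise distinct):
  `K(τ; S) = F(τ; a₁ … a_t; S)` — classify a representation by the first `aⱼ` it contains (iterated deletion
  identity `soloBlind_mass_erase`).
* COVER STEP (`soloBlind_firstHitSum_le_of_cover`, `soloBlind_mass_le_half_length_of_cover`): if every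
  representation of `τ` in `S` meets `{a₁, …, a_t}` (a transversal of the representation family) and every proper
  subsequence `S' ⊂ S` satisfies `K(σ; S') ≤ 1` for all targets `σ` (the induction hypothesis of (K₃); at `σ = 0`
  it is the zero-sum-free normalisation `K(0; S') = 1`), then `K(τ; S) ≤ t / 2`.
* In particular (`soloBlind_mass_le_one_of_cover_two`) a transversal of size `≤ 2` gives `K(τ; S) ≤ 1`: the
  inductive step of (K₃) is automatic on the class of targets whose representation family has transversal number
  `≤ 2`, and (`soloBlind_mass_le_half_of_cover_one`) a transversal of size `1` (a cone) gives `K(τ; S) ≤ 1/2`.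
* The exact two-cover identity (`soloBlind_mass_cover_two`):
  `K(τ; S) = K(τ - h a; S \ a)/2 + K(τ - h b; S \ {a, b})/2` when `{a, b}` is a transversal.
-/

namespace Summit.MatrixMultiplication.MatrixMultiplication.Theorems

open Finset

universe u

variable {ι : Type*} [DecidableEq ι]
variable {G : Type u} [AddCommGroup G] [DecidableEq G]

/-- The first-hit sum along the list `l = [a₁, …, a_t]`:
`K(τ - h a₁; S \ a₁)/2 + (first-hit sum of τ along [a₂, …, a_t] in S \ a₁)`, ending with `K(τ; S \ {a₁, …, a_t})`. -/
def soloBlindFirstHitSum (h : ι → G) (τ : G) : List ι → Finset ι → ℚ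
  | [], S => soloBlindMass h S τ
  | a :: l, S => 1 / 2 * soloBlindMass h (S.erase a) (τ - h a) + soloBlindFirstHitSum h τ l (S.erase a)

/-- Unfolding the first-hit sum on the empty list. -/
@[simp] theorem soloBlindFirstHitSum_nil (h : ι → G) (τ : G) (S : Finset ι) :
    soloBlindFirstHitSum h τ [] S = soloBlindMass h S τ := rfl

/-- Unfolding the first-hit sum on a nonempty list. -/
@[simp] theorem soloBlindFirstHitSum_cons (h : ι → G) (τ : G) (a : ι) (l : List ι) (S : Finset ι) :
    soloBlindFirstHitSum h τ (a :: l) S =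
      1 / 2 * soloBlindMass h (S.erase a) (τ - h a) + soloBlindFirstHitSum h τ l (S.erase a) := rfl

/-- FIRST-HIT DECOMPOSITION: for pairwise distinct `a₁, …, a_t ∈ S`,
`K(τ; S) = ∑ⱼ K(τ - h aⱼ; S \ {a₁, …, aⱼ})/2 + K(τ; S \ {a₁, …, a_t})`. -/
theorem soloBlind_mass_firstHit (h : ι → G) (τ : G) :
    ∀ (l : List ι) (S : Finset ι), l.Nodup → (∀ a ∈ l, a ∈ S) →
      soloBlindMass h S τ = soloBlindFirstHitSum h τ l S
  | [], S, _, _ => rfl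
  | a :: l, S, hnd, hlS => by
    rw [soloBlindFirstHitSum_cons, soloBlind_mass_erase h (hlS a (by simp)) τ, add_comm]
    congr 1
    refine soloBlind_mass_firstHit h τ l (S.erase a) (List.Nodup.of_cons hnd) fun b hb => ?_
    exact Finset.mem_erase.mpr ⟨fun e => (List.nodup_cons.mp hnd).1 (e ▸ hb), hlS b (by simp [hb])⟩

/-- A representation of `τ` inside `S \ a` is a representation inside `S` avoiding `a`. -/
theorem soloBlind_repAll_erase_sub {h : ι → G} {S : Finset ι} {a : ι} {τ : G} {T : Finset ι}
    (hT : T ∈ soloBlindSeqRepAll h (S.erase a) τ) : T ∈ soloBlindSeqRepAll h S τ ∧ a ∉ T := by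
  rw [← soloBlind_repAll_filter_not_mem, Finset.mem_filter] at hT
  exact hT

/-- COVER STEP for the first-hit sum: if every representation of `τ` in `S` meets the list `l` (pairwise distinct
elements of `S`) and every proper subsequence of `S` has all Kraft masses `≤ 1`, then the first-hit sum is at most
`|l| / 2`. -/
theorem soloBlind_firstHitSum_le_of_cover (h : ι → G) (τ : G) :
    ∀ (l : List ι) (S : Finset ι), l.Nodup → (∀ a ∈ l, a ∈ S) →
      (∀ T ∈ soloBlindSeqRepAll h S τ, ∃ a ∈ l, a ∈ T) →
      (∀ S' : Finset ι, S' ⊂ S → ∀ σ : G, soloBlindMass h S' σ ≤ 1) →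
      soloBlindFirstHitSum h τ l S ≤ l.length / 2
  | [], S, _, _, hcover, _ => by
    have hempty : soloBlindSeqRepAll h S τ = ∅ := by
      rw [Finset.eq_empty_iff_forall_notMem]
      intro T hT
      obtain ⟨a, ha, -⟩ := hcover T hT
      simp at ha
    rw [soloBlindFirstHitSum_nil, soloBlindMass, hempty, Finset.sum_empty]
    simp
  | a :: l, S, hnd, hlS, hcover, hK => by
    rw [soloBlindFirstHitSum_cons, List.length_cons]
    have haS : a ∈ S := hlS a (by simp)
    have hsub : S.erase a ⊂ S := Finset.erase_ssubset haS
    have h1 : soloBlindMass h (S.erase a) (τ - h a) ≤ 1 := hK _ hsub _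
    have h2 : soloBlindFirstHitSum h τ l (S.erase a) ≤ l.length / 2 := by
      refine soloBlind_firstHitSum_le_of_cover h τ l (S.erase a) (List.Nodup.of_cons hnd) ?_ ?_ ?_
      · intro b hb
        exact Finset.mem_erase.mpr ⟨fun e => (List.nodup_cons.mp hnd).1 (e ▸ hb), hlS b (by simp [hb])⟩
      · intro T hT
        obtain ⟨hTS, haT⟩ := soloBlind_repAll_erase_sub hT
        obtain ⟨b, hb, hbT⟩ := hcover T hTS
        rcases List.mem_cons.mp hb with rfl | hb'
        · exact (haT hbT).elim
        · exact ⟨b, hb', hbT⟩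
      · intro S' hS' σ
        exact hK S' (hS'.trans hsub) σ
    push_cast
    linarith

/-- COVER STEP of (K₃): if the representation family of `τ` in `S` has a transversal `{a₁, …, a_t} ⊆ S` and every
proper subsequence of `S` has all Kraft masses `≤ 1`, then `K(τ; S) ≤ t / 2`. -/
theorem soloBlind_mass_le_half_length_of_cover (h : ι → G) (τ : G) (l : List ι) (S : Finset ι)
    (hnd : l.Nodup) (hlS : ∀ a ∈ l, a ∈ S) (hcover : ∀ T ∈ soloBlindSeqRepAll h S τ, ∃ a ∈ l, a ∈ T)
    (hK : ∀ S' : Finset ι, S' ⊂ S → ∀ σ : G, soloBlindMass h S' σ ≤ 1) :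
    soloBlindMass h S τ ≤ l.length / 2 := by
  rw [soloBlind_mass_firstHit h τ l S hnd hlS]
  exact soloBlind_firstHitSum_le_of_cover h τ l S hnd hlS hcover hK

/-- TRANSVERSAL NUMBER ≤ 2: the inductive step of (K₃) is automatic — if every representation of `τ` contains `a` or
`b` and (K₃) (all masses `≤ 1`) holds for every proper subsequence of `S`, then `K(τ; S) ≤ 1`. -/
theorem soloBlind_mass_le_one_of_cover_two (h : ι → G) (τ : G) {S : Finset ι} {a b : ι} (ha : a ∈ S) (hb : b ∈ S)
    (hcover : ∀ T ∈ soloBlindSeqRepAll h S τ, a ∈ T ∨ b ∈ T)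
    (hK : ∀ S' : Finset ι, S' ⊂ S → ∀ σ : G, soloBlindMass h S' σ ≤ 1) :
    soloBlindMass h S τ ≤ 1 := by
  by_cases hab : a = b
  · subst hab
    have hc : ∀ T ∈ soloBlindSeqRepAll h S τ, ∃ c ∈ [a], c ∈ T := fun T hT => ⟨a, by simp, (hcover T hT).elim id id⟩
    have := soloBlind_mass_le_half_length_of_cover h τ [a] S (List.nodup_singleton a) (by simpa using ha) hc hK
    simp at this
    linarith
  · have hc : ∀ T ∈ soloBlindSeqRepAll h S τ, ∃ c ∈ [a, b], c ∈ T := fun T hT =>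
      (hcover T hT).elim (fun h' => ⟨a, by simp, h'⟩) (fun h' => ⟨b, by simp, h'⟩)
    have hnd : [a, b].Nodup := by simp [hab]
    have hlS : ∀ c ∈ [a, b], c ∈ S := by
      intro c hc'
      simp only [List.mem_cons, List.not_mem_nil, or_false] at hc'
      rcases hc' with rfl | rfl
      · exact ha
      · exact hb
    have := soloBlind_mass_le_half_length_of_cover h τ [a, b] S hnd hlS hc hK
    simp at this
    linarith

/-- TRANSVERSAL NUMBER 1 (a cone): if every representation of `τ` contains `a` and all masses of proper subsequences
are `≤ 1`, then `K(τ; S) ≤ 1/2`. -/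
theorem soloBlind_mass_le_half_of_cover_one (h : ι → G) (τ : G) {S : Finset ι} {a : ι} (ha : a ∈ S)
    (hcover : ∀ T ∈ soloBlindSeqRepAll h S τ, a ∈ T)
    (hK : ∀ S' : Finset ι, S' ⊂ S → ∀ σ : G, soloBlindMass h S' σ ≤ 1) :
    soloBlindMass h S τ ≤ 1 / 2 := by
  rw [soloBlind_mass_cone h ha τ hcover]
  have := hK (S.erase a) (Finset.erase_ssubset ha) (τ - h a)
  linarith

/-- The exact TWO-COVER IDENTITY: if every representation of `τ` in `S` contains `a` or `b` (`a ≠ b` in `S`), then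
`K(τ; S) = K(τ - h a; S \ a)/2 + K(τ - h b; (S \ a) \ b)/2`. -/
theorem soloBlind_mass_cover_two (h : ι → G) (τ : G) {S : Finset ι} {a b : ι} (ha : a ∈ S) (hb : b ∈ S)
    (hab : a ≠ b) (hcover : ∀ T ∈ soloBlindSeqRepAll h S τ, a ∈ T ∨ b ∈ T) :
    soloBlindMass h S τ =
      1 / 2 * soloBlindMass h (S.erase a) (τ - h a) + 1 / 2 * soloBlindMass h ((S.erase a).erase b) (τ - h b) := by
  have hnd : [a, b].Nodup := by simp [hab]
  have hlS : ∀ c ∈ [a, b], c ∈ S := by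
    intro c hc'
    simp only [List.mem_cons, List.not_mem_nil, or_false] at hc'
    rcases hc' with rfl | rfl
    · exact ha
    · exact hb
  rw [soloBlind_mass_firstHit h τ [a, b] S hnd hlS, soloBlindFirstHitSum_cons, soloBlindFirstHitSum_cons,
    soloBlindFirstHitSum_nil]
  have hempty : soloBlindSeqRepAll h ((S.erase a).erase b) τ = ∅ := by
    rw [Finset.eq_empty_iff_forall_notMem]
    intro T hT
    obtain ⟨hT', hbT⟩ := soloBlind_repAll_erase_sub hT
    obtain ⟨hT'', haT⟩ := soloBlind_repAll_erase_sub hT'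
    rcases hcover T hT'' with h' | h'
    · exact haT h'
    · exact hbT h'
  rw [show soloBlindMass h ((S.erase a).erase b) τ = 0 by rw [soloBlindMass, hempty, Finset.sum_empty], add_zero]

end Summit.MatrixMultiplication.MatrixMultiplication.Theorems
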